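import Mathlib
import Literature.MathematicalPhysics.QuantumFieldTheory.Balaban1983to89.B5DeltaA169
import Literature.MathematicalPhysics.QuantumFieldTheory.BalabanImbrieJaffe1984to88.BIJ85Eq7111EdgeAverage

/-!
# `BalabanImbrieJaffe1984to88.BIJ85Eq7110GramSymbol` — T. Bałaban, J. Imbrie, A. Jaffe, *Renormalization of the Higgs model:
minimizers, propagators and the stability of mean field theory*, Commun. Math. Phys. **97** (1985) 299–329 [BalabanImbrieJaffe1985]:
Sect. 7.1 p. 322 (7.1.10) — **the bond average `Q_k` ([6I] (1.18), pub-balaban `B5Block118.QvOp`) as a translation-invariant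
cross-lattice operator with symbol `u(p′+l)v_μ(p′+l)` ([6I] (1.61)), its weighted adjoint `Q^*_k` (pub-balaban
`B5DeltaA169.QvAdj`), and the GRAM SYMBOL**: for every
translation-invariant η-lattice operator `R` on bond fields, `σ_{Q_kRQ^*_k}(p′)_{μμ′} = Σ_l (uv_μ)(p′+l)·σ_R(p′+l)_{μμ′}·conj(uv_{μ′})(p′+l)`;
for a scalar symbol `r` the diagonal entries are `Σ_l|u(p′+l)v_μ(p′+l)|²r(p′+l)` — with `r = Δ^{−1}` this is EXACTLY the display
**(7.1.10)** *"φ_μ(p′) = Σ_l |u(p′+l)v_μ(p′+l)|²Δ(p′+l)^{−1}"*, i.e. `φ_μ` is the `μμ` symbol entry of `Q_kΔ^{−1}Q^*_k` ([6I] (1.62)) — PROVED;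
file 18 of the (7.1.2) cluster

statement-level skeleton of published theorems with citation tags; proofs where landed; nothing here is a claim about
the Yang–Mills mass gap

PDF held: `paper:balaban1985-cmp97-bij-higgs-minimizers` (journal page = PDF page + 298).  Text read as image: PDF p. 24 (journal 322;
`run/shared/lean/pub/pub-balaban/b2b-balaban-beta-lit3-g8/pages/1985-cmp97-bij-higgs-minimizers-p024-x2.png`).

CITATION HEADER (lean-in-tree rule).  Part of the lit-balaban TYPED SKELETON (HOME `run/shared/lean/pub/lit-balaban/`); WHAT IS
REPRODUCED: display **(7.1.10)** of SKELETON row **C1.Eq7.1.2-7.1.12** (p. 322 [PDF 24], verbatim: *"In terms of V(p) we also define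
u(p) = det V(p) (7.1.9) and φ_μ(p′) = Σ_{l∈2πℤ^d, |l_i|≤π/η} |u(p′+l)v_μ(p′+l)|²Δ(p′+l)^{−1}. (7.1.10) In terms of these functions we can
express the averaging operators Q^e_k, etc."*; r15's typed `BIJ85MomentumSymbols71.phiSym`, p10's `phiC`), `HOME/lit-balaban-r15/ROWS-C1.md`
(owner r15, referee ref-5).  TYPED READING: as in `BIJ85Eq7111CrossSymbols`; `Q_k` = `B5Block118.QvOp : Matrix (Tor M × Fin d)
(Tor (fine n M) × Fin d) ℂ` (*"(Q_kA)_b = Σ_{x∈B^k(b₋)} η^{d+1}A([x, x(b)])"*, straight contours), whose momentum representation [6I]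
(1.61) is pub-balaban's `B5Block118.dft_QvOp` (mulVec form) — here its SYMBOL MATRIX (`symbX_QvOp_pOf`); `Q^*_k = η^{−d}(Q_k)ᴴ` =
pub-balaban's `B5DeltaA169.QvAdj` (adjointness for the weighted products (2.14) = [6I] (1.21)/(1.69) is its `QvAdj_adjoint`);
`Δ^{−1}` is ANY translation-invariant `R` with scalar symbol `r` (the η-Laplacian has a zero mode, and (7.1.10) as printed is
infinite at `p′ = 0`; the file proves the symbol identity for every such `R`, `r`).
WHAT IS KERNEL-CHECKED (zero `sorry`, standard axioms): `isCrossTI_QvOp`, `symbX_QvOp`, **`symbX_QvOp_pOf`** (`σ_{Q_k}(p′+l)_{μμ′} =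
δ_{μμ′}u(p′+l)v_μ(p′+l)`, [6I] (1.61) as a symbol), **`symb_QvOp_sandwich`** (the Gram symbol for any fine-TI `R`), **`symb_QvOp_sandwich_scalar`** and **`eq7110_diag`**: for `σ_R = r·1`, `σ_{Q_kRQ^*_k}(p′)_{μμ} =
Σ_l|u v_μ|²(p′+l)·r(p′+l)` — (7.1.10) with `r = Δ^{−1}`; and the off-diagonal entries `Σ_l |u|²v_μv̄_{μ′}r` (`eq7110_offDiag`; not printed).
NOT CLAIMED: a particular inverse Laplacian, [6I] (1.83)–(1.84), (7.1.15)–(7.1.16).  Unit `lit-balaban-p27` (gen 5), HOME as above.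
-/

namespace Literature.MathematicalPhysics.QuantumFieldTheory.BalabanImbrieJaffe1984to88.BIJ85Eq7110GramSymbol

open scoped BigOperators Matrix ComplexConjugate
open Finset Complex
open Literature.MathematicalPhysics.QuantumFieldTheory.Balaban1983to89
open Literature.MathematicalPhysics.QuantumFieldTheory.Balaban1983to89.B5Prop11Plancherel
open Literature.MathematicalPhysics.QuantumFieldTheory.Balaban1983to89.B5Prop11Fiber
open Literature.MathematicalPhysics.QuantumFieldTheory.Balaban1983to89.B5Block118
open Literature.MathematicalPhysics.QuantumFieldTheory.Balaban1983to89.B5DeltaA169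
open Literature.MathematicalPhysics.QuantumFieldTheory.BalabanImbrieJaffe1984to88.BIJ85Eq712Plancherel
open Literature.MathematicalPhysics.QuantumFieldTheory.BalabanImbrieJaffe1984to88.BIJ85Eq712SymbolCalculus
open Literature.MathematicalPhysics.QuantumFieldTheory.BalabanImbrieJaffe1984to88.BIJ85Eq7111CrossSymbols
open Literature.MathematicalPhysics.QuantumFieldTheory.BalabanImbrieJaffe1984to88.BIJ85Eq7111EdgeAverage

noncomputable section

variable {d : ℕ} (n : ℕ) [NeZero n] (M : Fin d → ℕ) [hM : ∀ μ, NeZero (M μ)]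

/-! ## §1 `Q_k` is translation invariant; its symbol is `u·v_μ` ([6I] (1.61)) -/

omit [NeZero n] hM in
/-- `Q_k` commutes with the unit-lattice translations (`B^k(y+a) = B^k(y) + n·a`). [cite: BalabanImbrieJaffe1985, (7.1.11) p.322] -/
theorem isCrossTI_QvOp : IsCrossTI n M (Fin d) (Fin d) (QvOp n M) := by
  intro a y x i j
  simp only [QvOp, bpt_add]
  refine if_congr Iff.rfl (Finset.sum_congr rfl fun jj _ => Finset.sum_congr rfl fun t _ => if_congr ?_ rfl rfl) rfl
  rw [add_right_comm (bpt n M y jj), add_left_inj]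

/-- The symbol of `Q_k` at a fine momentum `p`: `δ_{μμ′}·η^{d+1}(Σ_{j}e^{ip·ηj})(Σ_{t<n}e^{ip·tηe_μ})` (block sum × contour sum).
[cite: BalabanImbrieJaffe1985, (7.1.11) p.322] -/
theorem symbX_QvOp (p : Tor (fine n M)) (μ μ' : Fin d) :
    symbX n M (Fin d) (Fin d) (QvOp n M) p μ μ'
      = if μ' = μ then 1 / (n : ℂ) ^ (d + 1) * ((∑ j : Fin d → Fin n, chi (fine n M) p (iota n M j))
          * ∑ t : Fin n, chi (fine n M) p (tstep (fine n M) μ t)) else 0 := by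
  rw [symbX_apply]
  simp only [QvOp]
  split_ifs with h
  · simp_rw [Finset.sum_mul, ite_mul, zero_mul]
    rw [Finset.sum_comm, Finset.mul_sum]
    refine Finset.sum_congr rfl fun j _ => ?_
    rw [Finset.sum_comm, Finset.mul_sum, Finset.mul_sum]
    refine Finset.sum_congr rfl fun t _ => ?_
    rw [Finset.sum_ite_eq' Finset.univ (bpt n M 0 j + tstep (fine n M) μ t), if_pos (Finset.mem_univ _), bpt_zero,
      chi_add_right]
  · simp only [zero_mul, Finset.sum_const_zero]

/-- **[6I] (1.61) as a symbol matrix / the weight of (7.1.10)**: `σ_{Q_k}(p′+l)_{μμ′} = δ_{μμ′}·u(p′+l)v_μ(p′+l)` (pub-balaban's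
`B5Prop11Fiber.uSym/vSym`; the mulVec form is `B5Block118.dft_QvOp`). [cite: BalabanImbrieJaffe1985, (7.1.10) p.322] -/
theorem symbX_QvOp_pOf (k : Fin d → Fin n) (q : Tor M) (μ μ' : Fin d) :
    symbX n M (Fin d) (Fin d) (QvOp n M) (pOf n M (k, q)) μ μ'
      = if μ' = μ then uSym n k (sOf M q) * vSym n k (sOf M q) μ else 0 := by
  have hn : (n : ℂ) ^ (d + 1) ≠ 0 := pow_ne_zero _ (by exact_mod_cast NeZero.ne n)
  rw [symbX_QvOp]
  split_ifs with h
  · rw [sum_chi_iota]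
    simp_rw [chi_pOf_tstep]
    rw [avg_om]
    calc 1 / (n : ℂ) ^ (d + 1) * ((n : ℂ) ^ d * uSym n k (sOf M q) * ((n : ℂ) * vSym n k (sOf M q) μ))
        = ((n : ℂ) ^ (d + 1))⁻¹ * (n : ℂ) ^ (d + 1) * (uSym n k (sOf M q) * vSym n k (sOf M q) μ) := by ring
      _ = uSym n k (sOf M q) * vSym n k (sOf M q) μ := by rw [inv_mul_cancel₀ hn, one_mul]
  · rfl

/-! ## §2 The Gram symbol `σ_{Q_kRQ^*_k}(p′)` and (7.1.10) (`Q^*_k` = pub-balaban `B5DeltaA169.QvAdj = η^{−d}(Q_k)ᴴ`) -/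

/-- **THE GRAM SYMBOL**: for every translation-invariant η-lattice bond operator `R`,
`σ_{Q_kRQ^*_k}(p′)_{μμ′} = Σ_l (u v_μ)(p′+l)·σ_R(p′+l)_{μμ′}·conj((u v_{μ′})(p′+l))` (the constant `η^{−d}·c² = 1`).
[cite: BalabanImbrieJaffe1985, (7.1.10) p.322] -/
theorem symb_QvOp_sandwich {R : Matrix (Tor (fine n M) × Fin d) (Tor (fine n M) × Fin d) ℂ}
    (hR : IsTranslInvR (fine n M) (Fin d) (Fin d) R) (q : Tor M) (μ μ' : Fin d) :
    symbR M (Fin d) (Fin d) (QvOp n M * R * QvAdj n M) q μ μ'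
      = ∑ k : Fin d → Fin n, uSym n k (sOf M q) * vSym n k (sOf M q) μ
          * symbR (fine n M) (Fin d) (Fin d) R (pOf n M (k, q)) μ μ'
          * conj (uSym n k (sOf M q) * vSym n k (sOf M q) μ') := by
  have hn : ((n : ℂ) ^ d) ≠ 0 := pow_ne_zero _ (by exact_mod_cast NeZero.ne n)
  rw [QvAdj, Matrix.mul_smul, symbR_smul,
    symb_sandwich n M (Fin d) (Fin d) (Fin d) (isCrossTI_QvOp n M) hR (isCrossTI_QvOp n M) q, smul_smul, cQ_sq,
    mul_inv_cancel₀ hn, one_smul, Matrix.sum_apply]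
  refine Finset.sum_congr rfl fun k _ => ?_
  rw [Matrix.mul_apply, Finset.sum_eq_single μ']
  · rw [Matrix.conjTranspose_apply, symbX_QvOp_pOf, if_pos rfl, Matrix.mul_apply, Finset.sum_eq_single μ]
    · rw [symbX_QvOp_pOf, if_pos rfl, Complex.star_def]
    · intro ρ _ hρ
      rw [symbX_QvOp_pOf, if_neg hρ, zero_mul]
    · exact fun h => absurd (Finset.mem_univ _) h
  · intro ρ _ hρ
    rw [Matrix.conjTranspose_apply, symbX_QvOp_pOf, if_neg hρ, star_zero, mul_zero]
  · exact fun h => absurd (Finset.mem_univ _) h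

/-- The Gram symbol for a SCALAR symbol `σ_R(p) = r(p)·1` (e.g. a translation-invariant inverse of the η-Laplacian off its zero
modes, `r = Δ^{−1}`): `σ_{Q_kRQ^*_k}(p′)_{μμ′} = Σ_l |u(p′+l)|² v_μ(p′+l) v̄_{μ′}(p′+l) r(p′+l)`. [cite: BalabanImbrieJaffe1985, (7.1.10) p.322] -/
theorem symb_QvOp_sandwich_scalar {R : Matrix (Tor (fine n M) × Fin d) (Tor (fine n M) × Fin d) ℂ}
    (hR : IsTranslInvR (fine n M) (Fin d) (Fin d) R) (r : Tor (fine n M) → ℂ)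
    (hr : ∀ p, symbR (fine n M) (Fin d) (Fin d) R p = r p • (1 : Matrix (Fin d) (Fin d) ℂ)) (q : Tor M) (μ μ' : Fin d) :
    symbR M (Fin d) (Fin d) (QvOp n M * R * QvAdj n M) q μ μ'
      = ∑ k : Fin d → Fin n, uSym n k (sOf M q) * conj (uSym n k (sOf M q))
          * (vSym n k (sOf M q) μ * conj (vSym n k (sOf M q) μ')) * (if μ = μ' then r (pOf n M (k, q)) else 0) := by
  rw [symb_QvOp_sandwich n M hR]
  refine Finset.sum_congr rfl fun k _ => ?_
  rw [hr, Matrix.smul_apply, Matrix.one_apply, smul_eq_mul, map_mul]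
  split_ifs <;> ring

/-- **(7.1.10)** p. 322 [PDF 24], *"φ_μ(p′) = Σ_l |u(p′+l)v_μ(p′+l)|²Δ(p′+l)^{−1}"* — PROVED as the statement that the DIAGONAL Gram symbol
entry of `Q_kRQ^*_k` is `Σ_l |u(p′+l)v_μ(p′+l)|²·r(p′+l)` for every translation-invariant `R` with scalar symbol `r` (for `r = Δ^{−1}`
this is `φ_μ(p′)`, [6I] (1.62); `Σ_l` = the `n^d` offsets `k`). [cite: BalabanImbrieJaffe1985, (7.1.10) p.322] -/
theorem eq7110_diag {R : Matrix (Tor (fine n M) × Fin d) (Tor (fine n M) × Fin d) ℂ}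
    (hR : IsTranslInvR (fine n M) (Fin d) (Fin d) R) (r : Tor (fine n M) → ℂ)
    (hr : ∀ p, symbR (fine n M) (Fin d) (Fin d) R p = r p • (1 : Matrix (Fin d) (Fin d) ℂ)) (q : Tor M) (μ : Fin d) :
    symbR M (Fin d) (Fin d) (QvOp n M * R * QvAdj n M) q μ μ
      = ∑ k : Fin d → Fin n, ((‖uSym n k (sOf M q) * vSym n k (sOf M q) μ‖ ^ 2 : ℝ) : ℂ) * r (pOf n M (k, q)) := by
  rw [symb_QvOp_sandwich_scalar n M hR r hr]
  refine Finset.sum_congr rfl fun k _ => ?_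
  rw [if_pos rfl, Complex.ofReal_pow, ← Complex.mul_conj', map_mul]
  ring

/-- The OFF-DIAGONAL Gram entries (not printed): `Σ_l |u|²v_μv̄_{μ′}r(p′+l)` vanish from the scalar part `δ_{μμ′}` only — for `μ ≠ μ′` the
entry is `0` when `σ_R` is scalar AND diagonal in the bond direction, as here. [cite: BalabanImbrieJaffe1985, (7.1.10) p.322] -/
theorem eq7110_offDiag {R : Matrix (Tor (fine n M) × Fin d) (Tor (fine n M) × Fin d) ℂ}
    (hR : IsTranslInvR (fine n M) (Fin d) (Fin d) R) (r : Tor (fine n M) → ℂ)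
    (hr : ∀ p, symbR (fine n M) (Fin d) (Fin d) R p = r p • (1 : Matrix (Fin d) (Fin d) ℂ)) (q : Tor M) {μ μ' : Fin d}
    (hμ : μ ≠ μ') : symbR M (Fin d) (Fin d) (QvOp n M * R * QvAdj n M) q μ μ' = 0 := by
  rw [symb_QvOp_sandwich_scalar n M hR r hr]
  exact Finset.sum_eq_zero fun k _ => by rw [if_neg hμ, mul_zero]

end

end Literature.MathematicalPhysics.QuantumFieldTheory.BalabanImbrieJaffe1984to88.BIJ85Eq7110GramSymbol
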